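import Summits.Langlands.Langlands.Theorems.PotentialCompanionDescentBrauerTaylorDescentDescentData
import HarnessLib

/-!
# Brauer–Taylor descent for `PotentialCompanionDescent.BrauerTaylorDescent` — the single-index pairing

Part 3a of the lineage programme (Barnet-Lamb–Gee–Geraghty–Taylor 2014, proof of Thm. 5.5.1).
For Brauer data `1 = ∑ᵢ nᵢ Ind_{H̄ᵢ}^Q θᵢ` on a finite group `Q` and ANY subgroup `T ≤ Q`, the
SINGLE-index pairing

  `∑ᵢ nᵢ ⟨Ind_T^Q 1, Ind_{H̄ᵢ}^Q θᵢ⟩_Q = ⟨Ind_T 1, 1⟩_Q = ⟨1, 1⟩_T = 1`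

(Frobenius reciprocity), computed — exactly as the double-index count `(B, B) = 1` of
`…BrauerPairing` — as the number of double cosets `q ∈ T\Q/H̄ᵢ` on which `θᵢ` is trivial on
`H̄ᵢ ∩ g_q⁻¹ T g_q`, then transported to `dim_k Hom_Q(coind_T k, coind_{H̄ᵢ} k(θ̃ᵢ))` over an
algebraically closed `k` (`e : ℂ →+* k`, `θ̃ᵢ = e ∘ θᵢ`) and inflated along a surjection
`π : Γ ↠ Q` (`finrank_intertwiningMap_coind_comap`):

* `sum_finrank_intertwiningMap_coind_comap_one_eq_one`:
  `∑ᵢ nᵢ dim_k Hom_Γ(coind_{π⁻¹H̄ⱼ}^Γ k, coind_{π⁻¹H̄ᵢ}^Γ k(ψᵢ)) = 1` for every `j`, with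
  `ψᵢ = θ̃ᵢ ∘ π` the inflated characters of `exists_brauerTaylor_descentData`.

This is the number that identifies the restriction `W|_{Hⱼ}` of the virtual-Brauer-descended
representation `W` with `rⱼ` (`…Restriction`).

References: BLGGT, Ann. of Math. 179 (2014), proof of Thm. 5.5.1; Serre, *Linear Representations
of Finite Groups*, §7.2 Thm. 13 (Frobenius reciprocity), §7.3 (Mackey).
-/

set_option linter.dupNamespace false

noncomputable section

open scoped BigOperators
open Literature.RepresentationTheory.FiniteGroups Literature.RepresentationTheory.Semisimple

namespace Summit.Langlands.Langlands.Theorems.BrauerTaylorDescent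

variable {G : Type} [Group G]

/-! ## Over `ℂ` -/

section PairingOverC

variable [Fintype G]

open scoped Classical in
/-- **`⟨Ind_S α, Ind_T β⟩_G = #{q ∈ S\G/T : α^{g_q} = β on T ∩ g_q⁻¹ S g_q}`** for degree-one
characters `α : S →* ℂˣ`, `β : T →* ℂˣ` (reciprocity, Mackey for class functions, reciprocity,
orthonormality of degree-one characters).
[cite: SerreLinearRepresentations1977, §7.2 Thm. 13, §7.3] -/
theorem classInner_indClassFun_hom (S T : Subgroup G) (α : S →* ℂˣ) (β : T →* ℂˣ) :
    classInner (indClassFun S (fun h => ((α h : ℂˣ) : ℂ)))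
        (indClassFun T (fun h => ((β h : ℂˣ) : ℂ))) =
      ∑ q : DoubleCoset.Quotient (S : Set G) (T : Set G),
        (if α.comp (mackeyConjHom S T q.out) = β.comp (mackeySubgroup S T q.out).subtype
          then (1 : ℂ) else 0) := by
  classical
  haveI : ∀ q : DoubleCoset.Quotient (S : Set G) (T : Set G),
      Fintype (mackeySubgroup S T q.out) := fun q => Fintype.ofFinite _
  haveI : Fintype S := Fintype.ofFinite _
  haveI : Fintype T := Fintype.ofFinite _
  rw [classInner_indClassFun_right T _ (isClassFun_indClassFun S _)]
  have hM : (fun x : T => indClassFun S (fun h => ((α h : ℂˣ) : ℂ)) (x : G)) =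
      ∑ q : DoubleCoset.Quotient (S : Set G) (T : Set G),
        indClassFun (mackeySubgroup S T q.out)
          ((fun h : S => ((α h : ℂˣ) : ℂ)) ∘ mackeyConjHom S T q.out) := by
    funext x
    rw [Finset.sum_apply]
    exact indClassFun_restrict_eq_sum_doubleCoset S T (isClassFun_coe_hom α) x
  rw [hM, classInner_finset_sum_left]
  refine Finset.sum_congr rfl fun q _ => ?_
  rw [classInner_indClassFun_left (mackeySubgroup S T q.out) _ (isClassFun_coe_hom β)]
  exact classInner_coe_hom (α.comp (mackeyConjHom S T q.out))
    (β.comp (mackeySubgroup S T q.out).subtype)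

open scoped Classical in
/-- **The single-index Brauer pairing count**: if `∑ᵢ nᵢ Ind_{Hᵢ}^G θᵢ = 1`, then for every
subgroup `T ≤ G`,
`∑ᵢ nᵢ #{q ∈ T\G/Hᵢ : θᵢ = 1 on Hᵢ ∩ g_q⁻¹ T g_q} = ∑ᵢ nᵢ ⟨Ind_T 1, Ind θᵢ⟩ = ⟨Ind_T 1, 1⟩ = 1`.
[cite: BarnetlambEtAl2014, proof of Thm. 5.5.1] [cite: SerreLinearRepresentations1977, §7.2 Thm. 13] -/
theorem sum_card_doubleCoset_one_eq_one {ι : Type} [Fintype ι] (H : ι → Subgroup G)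
    (θ : ∀ i, H i →* ℂˣ) (n : ι → ℤ)
    (hB : ∀ s : G, ∑ i, (n i : ℂ) * indClassFun (H i) (fun h => ((θ i h : ℂˣ) : ℂ)) s = 1)
    (T : Subgroup G) :
    (∑ i, n i * ∑ q : DoubleCoset.Quotient (T : Set G) (H i : Set G),
      (if (1 : T →* ℂˣ).comp (mackeyConjHom T (H i) q.out) =
          (θ i).comp (mackeySubgroup T (H i) q.out).subtype then (1 : ℤ) else 0)) = 1 := by
  classical
  haveI : Fintype T := Fintype.ofFinite _
  -- `F i = Ind θᵢ`, `B = ∑ nᵢ F i = 1`, `E = Ind_T 1`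
  set F : ι → G → ℂ := fun i => indClassFun (H i) (fun h => ((θ i h : ℂˣ) : ℂ)) with hF
  set B : G → ℂ := ∑ i, (n i : ℂ) • F i with hBdef
  set E : G → ℂ := indClassFun T (fun h => (((1 : T →* ℂˣ) h : ℂˣ) : ℂ)) with hE
  have hB1 : B = 1 := by
    funext s
    simp only [hBdef, Finset.sum_apply, Pi.smul_apply, smul_eq_mul, Pi.one_apply]
    exact hB s
  -- `⟨E, 1⟩ = ⟨1|_T, 1_T⟩ = 1`
  have h11 : classInner B E = 1 := by
    rw [hB1, hE, classInner_indClassFun_right T _ (fun _ _ => rfl)]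
    have := classInner_coe_hom (1 : T →* ℂˣ) (1 : T →* ℂˣ)
    rw [if_pos rfl] at this
    rw [← this]
    rfl
  -- expansion in the first variable
  have hexp : classInner B E = ∑ i, (n i : ℂ) * classInner E (F i) := by
    rw [hBdef, classInner_finset_sum_left]
    refine Finset.sum_congr rfl fun i _ => ?_
    rw [classInner_smul_left, classInner_comm]
  have hC : (∑ i, (n i : ℂ) * ∑ q : DoubleCoset.Quotient (T : Set G) (H i : Set G),
      (if (1 : T →* ℂˣ).comp (mackeyConjHom T (H i) q.out) =
          (θ i).comp (mackeySubgroup T (H i) q.out).subtype then (1 : ℂ) else 0)) = 1 := by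
    refine Eq.trans ?_ (hexp.symm.trans h11)
    refine Finset.sum_congr rfl fun i _ => ?_
    rw [hE, hF, classInner_indClassFun_hom]
  have hZ : ((∑ i, n i * ∑ q : DoubleCoset.Quotient (T : Set G) (H i : Set G),
      (if (1 : T →* ℂˣ).comp (mackeyConjHom T (H i) q.out) =
          (θ i).comp (mackeySubgroup T (H i) q.out).subtype then (1 : ℤ) else 0) : ℤ) : ℂ) =
      ∑ i, (n i : ℂ) * ∑ q : DoubleCoset.Quotient (T : Set G) (H i : Set G),
        (if (1 : T →* ℂˣ).comp (mackeyConjHom T (H i) q.out) =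
            (θ i).comp (mackeySubgroup T (H i) q.out).subtype then (1 : ℂ) else 0) := by
    push_cast
    rfl
  exact_mod_cast hZ.trans hC

end PairingOverC

/-! ## Over an algebraically closed `k`, and inflated along `Γ ↠ Q` -/

section PairingOverK

variable {k : Type} [Field k] [IsAlgClosed k] {Q : Type} [Group Q] [Fintype Q]

/-- **`∑ᵢ nᵢ dim_k Hom_Q(coind_T k, coind_{Hᵢ} k(θ̃ᵢ)) = 1`** for Brauer data transported along
`e : ℂ →+* k` (`finrank_intertwiningMap_coind_ofChar` + `sum_card_doubleCoset_one_eq_one`).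
[cite: BarnetlambEtAl2014, proof of Thm. 5.5.1] -/
theorem sum_finrank_intertwiningMap_coind_one_eq_one (e : ℂ →+* k) {ι : Type} [Fintype ι]
    (H : ι → Subgroup Q) (θ : ∀ i, H i →* ℂˣ) (n : ι → ℤ)
    (hB : ∀ s : Q, ∑ i, (n i : ℂ) * indClassFun (H i) (fun h => ((θ i h : ℂˣ) : ℂ)) s = 1)
    (T : Subgroup Q) :
    (∑ i, n i * (Module.finrank k (Representation.IntertwiningMap
        (Representation.coind T.subtype (Representation.ofChar (1 : T →* kˣ)))
        (Representation.coind (H i).subtype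
          (Representation.ofChar ((Units.map (e : ℂ →* k)).comp (θ i))))) : ℤ)) = 1 := by
  classical
  rw [← sum_card_doubleCoset_one_eq_one H θ n hB T]
  refine Finset.sum_congr rfl fun i _ => ?_
  rw [finrank_intertwiningMap_coind_ofChar]
  push_cast
  congr 1
  refine Finset.sum_congr rfl fun q _ => ?_
  have hinj : Function.Injective (Units.map (e : ℂ →* k)) := Units.map_injective e.injective
  by_cases hc : (1 : T →* ℂˣ).comp (mackeyConjHom T (H i) q.out) =
      (θ i).comp (mackeySubgroup T (H i) q.out).subtype
  · have hc' : (1 : T →* kˣ).comp (mackeyConjHom T (H i) q.out) =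
        ((Units.map (e : ℂ →* k)).comp (θ i)).comp (mackeySubgroup T (H i) q.out).subtype := by
      rw [MonoidHom.one_comp, MonoidHom.comp_assoc, ← hc, MonoidHom.one_comp, MonoidHom.comp_one]
    rw [if_pos hc, if_pos hc']
  · have hc' : ¬ (1 : T →* kˣ).comp (mackeyConjHom T (H i) q.out) =
        ((Units.map (e : ℂ →* k)).comp (θ i)).comp (mackeySubgroup T (H i) q.out).subtype := by
      intro h'
      apply hc
      ext1 x
      apply hinj
      have := DFunLike.congr_fun h' x
      simp only [MonoidHom.one_comp, MonoidHom.one_apply, MonoidHom.comp_apply] at this ⊢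
      rw [map_one]
      exact this
    rw [if_neg hc, if_neg hc']

/-- **Inflated single-index pairing**: for a surjection `π : Γ ↠ Q` and Brauer data on `Q`,
`∑ᵢ nᵢ dim_k Hom_Γ(coind_{π⁻¹H̄ⱼ}^Γ k, coind_{π⁻¹H̄ᵢ}^Γ k(ψᵢ)) = 1` for every `j`, where
`ψᵢ = (e ∘ θᵢ) ∘ π` are the inflated characters of `exists_brauerTaylor_descentData`
(`finrank_intertwiningMap_coind_comap`).  This is the number identifying `W|_{Hⱼ}` with `rⱼ` in
the Brauer–Taylor descent. [cite: BarnetlambEtAl2014, proof of Thm. 5.5.1] -/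
theorem sum_finrank_intertwiningMap_coind_comap_one_eq_one {Γ : Type} [Group Γ] (π : Γ →* Q)
    (hπ : Function.Surjective π) (e : ℂ →+* k) {ι : Type} [Fintype ι]
    (H : ι → Subgroup Q) (θ : ∀ i, H i →* ℂˣ) (n : ι → ℤ)
    (hB : ∀ s : Q, ∑ i, (n i : ℂ) * indClassFun (H i) (fun h => ((θ i h : ℂˣ) : ℂ)) s = 1)
    (j : ι) :
    (∑ i, n i * (Module.finrank k (Representation.IntertwiningMap
        (Representation.coind ((H j).comap π).subtype
          (Representation.ofChar (1 : (H j).comap π →* kˣ)))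
        (Representation.coind ((H i).comap π).subtype (Representation.ofChar
          (((Units.map (e : ℂ →* k)).comp (θ i)).comp (π.subgroupComap (H i)))))) : ℤ)) = 1 := by
  have h1 : (1 : (H j).comap π →* kˣ) = (1 : H j →* kˣ).comp (π.subgroupComap (H j)) := by
    rw [MonoidHom.one_comp]
  rw [h1]
  simp_rw [finrank_intertwiningMap_coind_comap π hπ]
  exact sum_finrank_intertwiningMap_coind_one_eq_one e H θ n hB (H j)

end PairingOverK

end Summit.Langlands.Langlands.Theorems.BrauerTaylorDescent

end
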